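import Summits.Parity.GeneralizedHardyLittlewood.Theorems.LeeYangFibresCellParityLawFibreInheritanceAux
import HarnessLib

/-!
# Route `LeeYangFibres`, crux `CellParityLaw` (stmt-Parity-14109), line `section-annihilator`:
# the registered stub `stub_coveringInequality` — body-by-body Type-I bounds give strong ones

Skeleton v18 (lead c5). This file proves `CoveringInequality` (vocabulary file
`LeeYangFibresCellParityLawP2Defs`): for a sifted sequence with weights `a_n ∈ [0, 1]`, size = counting
function and a multiplicative density of Iwaniec dimension `Ω(1, L')`, the strong (Bombieri–Friedlander–Iwaniec
(A₂)) Type-I sum `Σ_{d ≤ x^{1-η} sqfree} |r_d(y_d)|` over an arbitrary selection of truncations `y_d ≤ x` is at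
most `(Y + 2) Rw + C (x/Y + x^{1-η}) log x`, where `Rw` bounds every body-by-body sum
`Σ_{d ≤ x^{1-η} sqfree} |r_d(y)|`, `y ≤ x`. Constants: `A₃ = 1`, `C = 3 + 4(1 + 2|L'|)`.

Proof (a covering/grid argument, elementary):

* the remainder only sees `⌊y⌋₊`, so every truncation is an integer `n_d ≤ ⌊x⌋₊`;
* between integer truncations `n ≤ n'` the counting functions increase by
  `A_d(n') − A_d(n) = Σ_{n < m ≤ n', d ∣ m} a_m ∈ [0, ⌊n'/d⌋ − ⌊n/d⌋] ⊆ [0, (n'−n)/d + 1]` and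
  `A(n') − A(n) ∈ [0, n' − n]`, whence `|r_d(n') − r_d(n)| ≤ (n'−n)/d + 1 + g(d)(n'−n)`
  (`CoveringAux.abs_remainder_sub_le`);
* with the mesh `s = ⌈x/Y⌉ ∈ [x/Y, x/Y + 1)` round `n_d` down to the multiple `t_d = ⌊n_d/s⌋ s` of `s`:
  `n_d − t_d ≤ s − 1 ≤ x/Y`, so `|r_d(y_d)| ≤ |r_d(t_d)| + (x/Y)/d + 1 + g(d) x/Y`, and `|r_d(t_d)|` is
  one term of `Σ_{k ≤ ⌊x⌋₊/s} |r_d(k s)|` (`CoveringAux.abs_remainder_le_grid`);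
* summing over `d` and exchanging the sums, the grid contributes `(⌊x⌋₊/s + 1) Rw ≤ (Y + 1) Rw`
  (each `k s ≤ x`), and the rounding errors contribute
  `(x/Y) Σ 1/d + #𝒟 + (x/Y) Σ g(d) ≤ (x/Y)(1 + log x) + x^{1-η} + (x/Y) · 4(1+2|L'|) log x`
  (harmonic bound; `FibreInheritanceAux.sum_squarefree_density_le_log`), which is
  `≤ Rw + (3 + 4(1+2|L'|)) (x/Y + x^{1-η}) log x` as `2 log x ≥ 1`.

The hypothesis `g(p) ≤ A₁/p` of `CoveringInequality` is not needed.

References: E. Bombieri, J. Friedlander, H. Iwaniec, Acta Math. 156 (1986), hypothesis (A₂)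
[BombieriFriedlanderIwaniecActa1986]; J. Friedlander, H. Iwaniec, Ann. Sc. Norm. Sup. Pisa (4) 5 (1978) §4
[FriedlanderIwaniecPisa1978].
-/

noncomputable section

open scoped BigOperators Classical
open Finset Literature.NumberTheory.Sieve

namespace Summit.Parity.GeneralizedHardyLittlewood.Cruxes.CellParityLaw.SectionAnnihilator

namespace CoveringAux

/-! ## Increments of the counting functions between integer truncations -/

/-- `A_d(n') − A_d(n) = Σ_{n < m ≤ n', d ∣ m} a_m` for integers `n ≤ n'`. [folklore] -/
theorem congrSum_sub_eq (𝒜 : SieveSequence) (d : ℕ) {n n' : ℕ} (h : n ≤ n') :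
    𝒜.congrSum d n' - 𝒜.congrSum d n = ∑ m ∈ (Finset.Ioc n n').filter (d ∣ ·), 𝒜.a m := by
  unfold SieveSequence.congrSum
  rw [Nat.floor_natCast, Nat.floor_natCast, ← Finset.Ioc_union_Ioc_eq_Ioc (Nat.zero_le n) h,
    Finset.filter_union, Finset.sum_union]
  · ring
  · exact Finset.disjoint_filter_filter (Finset.Ioc_disjoint_Ioc_of_le le_rfl)

/-- `0 ≤ A_d(n') − A_d(n)` for integers `n ≤ n'` (nonnegative weights). [folklore] -/
theorem congrSum_sub_nonneg (𝒜 : SieveSequence) (d : ℕ) {n n' : ℕ} (h : n ≤ n') :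
    0 ≤ 𝒜.congrSum d n' - 𝒜.congrSum d n := by
  rw [congrSum_sub_eq 𝒜 d h]
  exact Finset.sum_nonneg fun m _ => 𝒜.a_nonneg m

/-- With weights `≤ 1`: `A_d(n') − A_d(n) ≤ #{n < m ≤ n' : d ∣ m}`. [folklore] -/
theorem congrSum_sub_le_card (𝒜 : SieveSequence) (ha : ∀ q : ℕ, 𝒜.a q ≤ 1) (d : ℕ) {n n' : ℕ}
    (h : n ≤ n') :
    𝒜.congrSum d n' - 𝒜.congrSum d n ≤ (((Finset.Ioc n n').filter (d ∣ ·)).card : ℝ) := by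
  rw [congrSum_sub_eq 𝒜 d h]
  calc ∑ m ∈ (Finset.Ioc n n').filter (d ∣ ·), 𝒜.a m
      ≤ ∑ m ∈ (Finset.Ioc n n').filter (d ∣ ·), (1 : ℝ) := Finset.sum_le_sum fun m _ => ha m
    _ = (((Finset.Ioc n n').filter (d ∣ ·)).card : ℝ) := by
        rw [Finset.sum_const, nsmul_eq_mul, mul_one]

/-- The multiples of `d ≥ 1` in `(n, n']` number `⌊n'/d⌋ − ⌊n/d⌋ ≤ (n' − n)/d + 1`. [folklore] -/
theorem card_Ioc_filter_dvd_le {d : ℕ} (hd : 0 < d) {n n' : ℕ} (h : n ≤ n') :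
    (((Finset.Ioc n n').filter (d ∣ ·)).card : ℝ) ≤ ((n' : ℝ) - n) / d + 1 := by
  have hcard : ((Finset.Ioc n n').filter (d ∣ ·)).card + n / d = n' / d := by
    rw [← Nat.Ioc_filter_dvd_card_eq_div n d, ← Nat.Ioc_filter_dvd_card_eq_div n' d,
      ← Finset.card_union_of_disjoint, ← Finset.filter_union, Finset.union_comm,
      Finset.Ioc_union_Ioc_eq_Ioc (Nat.zero_le n) h]
    exact Finset.disjoint_filter_filter (Finset.Ioc_disjoint_Ioc_of_le le_rfl).symm
  have hd0 : (0 : ℝ) < d := by exact_mod_cast hd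
  have h1 : ((n' / d : ℕ) : ℝ) ≤ (n' : ℝ) / d := Nat.cast_div_le
  have h2 : (n : ℝ) / d < ((n / d : ℕ) : ℝ) + 1 := by
    rw [div_lt_iff₀ hd0]
    have h' : (n : ℝ) < ((n / d : ℕ) : ℝ) * d + d := by exact_mod_cast Nat.lt_div_mul_add hd
    linarith
  have h3 : (((Finset.Ioc n n').filter (d ∣ ·)).card : ℝ) + ((n / d : ℕ) : ℝ) = ((n' / d : ℕ) : ℝ) := by
    exact_mod_cast hcard
  rw [sub_div]
  linarith

/-- `#(n, n'] = n' − n`: with weights `≤ 1`, `A_1(n') − A_1(n) ≤ n' − n`. [folklore] -/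
theorem congrSum_one_sub_le (𝒜 : SieveSequence) (ha : ∀ q : ℕ, 𝒜.a q ≤ 1) {n n' : ℕ} (h : n ≤ n') :
    𝒜.congrSum 1 n' - 𝒜.congrSum 1 n ≤ (n' : ℝ) - n := by
  refine (congrSum_sub_le_card 𝒜 ha 1 h).trans (le_of_eq ?_)
  rw [Finset.filter_true_of_mem fun m _ => one_dvd m, Nat.card_Ioc, Nat.cast_sub h]

/-- **Increments of the remainder**: for integers `n ≤ n'`, weights in `[0, 1]`, size = counting function
and `g(d) ≥ 0`, `|r_d(n') − r_d(n)| ≤ (n'−n)/d + 1 + g(d)(n' − n)`. [folklore] -/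
theorem abs_remainder_sub_le (𝒜 : SieveSequence) (ha : ∀ q : ℕ, 𝒜.a q ≤ 1)
    (hsize : ∀ y : ℝ, 𝒜.size y = 𝒜.congrSum 1 y) {d : ℕ} (hd : 0 < d) (hg : 0 ≤ 𝒜.density d)
    {n n' : ℕ} (h : n ≤ n') :
    |𝒜.remainder d n' - 𝒜.remainder d n| ≤
      ((n' : ℝ) - n) / d + 1 + 𝒜.density d * ((n' : ℝ) - n) := by
  have e : 𝒜.remainder d n' - 𝒜.remainder d n =
      (𝒜.congrSum d n' - 𝒜.congrSum d n) -
        𝒜.density d * (𝒜.congrSum 1 n' - 𝒜.congrSum 1 n) := by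
    simp only [SieveSequence.remainder, hsize]
    ring
  have h1 := congrSum_sub_nonneg 𝒜 d h
  have h2 := (congrSum_sub_le_card 𝒜 ha d h).trans (card_Ioc_filter_dvd_le hd h)
  have h3 := congrSum_sub_nonneg 𝒜 1 h
  have h4 := congrSum_one_sub_le 𝒜 ha h
  have h5 : 0 ≤ 𝒜.density d * (𝒜.congrSum 1 n' - 𝒜.congrSum 1 n) := mul_nonneg hg h3
  have h6 : 𝒜.density d * (𝒜.congrSum 1 n' - 𝒜.congrSum 1 n) ≤ 𝒜.density d * ((n' : ℝ) - n) :=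
    mul_le_mul_of_nonneg_left h4 hg
  have h7 : (0 : ℝ) ≤ ((n' : ℝ) - n) / d :=
    div_nonneg (sub_nonneg.mpr (by exact_mod_cast h)) (Nat.cast_nonneg d)
  rw [e, abs_le]
  constructor <;> linarith

/-- The remainder only sees `⌊y⌋₊` (size = counting function): `r_d(y) = r_d(⌊y⌋₊)`. [folklore] -/
theorem remainder_eq_floor (𝒜 : SieveSequence) (hsize : ∀ y : ℝ, 𝒜.size y = 𝒜.congrSum 1 y)
    (d : ℕ) (y : ℝ) : 𝒜.remainder d y = 𝒜.remainder d (⌊y⌋₊ : ℝ) := by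
  simp only [SieveSequence.remainder, hsize, SieveSequence.congrSum, Nat.floor_natCast]

/-! ## Rounding down to the grid -/

/-- **Rounding a truncation down to the grid** `{k s : 0 ≤ k ≤ ⌊x⌋₊/s}` of mesh `s ≤ B + 1`: for
`y ≤ x`, `|r_d(y)| ≤ Σ_{k ≤ ⌊x⌋₊/s} |r_d(k s)| + (B/d + 1 + g(d) B)` (`n = ⌊y⌋₊`, `t = ⌊n/s⌋ s`,
`n − t ≤ s − 1 ≤ B`). [folklore] -/
theorem abs_remainder_le_grid (𝒜 : SieveSequence) (ha : ∀ q : ℕ, 𝒜.a q ≤ 1)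
    (hsize : ∀ y : ℝ, 𝒜.size y = 𝒜.congrSum 1 y) {d : ℕ} (hd : 0 < d) (hg : 0 ≤ 𝒜.density d)
    {s : ℕ} (hs : 0 < s) {B : ℝ} (hB : (s : ℝ) ≤ B + 1) {x y : ℝ} (hyx : y ≤ x) :
    |𝒜.remainder d y| ≤
      ∑ k ∈ Finset.range (⌊x⌋₊ / s + 1), |𝒜.remainder d ((k * s : ℕ) : ℝ)| +
        (B / d + 1 + 𝒜.density d * B) := by
  set n : ℕ := ⌊y⌋₊ with hn
  have hnx : n ≤ ⌊x⌋₊ := Nat.floor_le_floor hyx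
  have htn : n / s * s ≤ n := Nat.div_mul_le_self n s
  -- the rounding error `n − ⌊n/s⌋ s = n % s ≤ s − 1 ≤ B`
  have hmod : (n : ℝ) - ((n / s * s : ℕ) : ℝ) ≤ B := by
    have h1 : n / s * s + n % s = n := Nat.div_add_mod' n s
    have h2 : n % s < s := Nat.mod_lt n hs
    have h3 : ((n / s * s : ℕ) : ℝ) + ((n % s : ℕ) : ℝ) = (n : ℝ) := by exact_mod_cast h1
    have h4 : ((n % s : ℕ) : ℝ) + 1 ≤ s := by exact_mod_cast h2
    linarith
  have hdiff := abs_remainder_sub_le 𝒜 ha hsize hd hg htn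
  have hd0 : (0 : ℝ) < d := by exact_mod_cast hd
  have herr : ((n : ℝ) - ((n / s * s : ℕ) : ℝ)) / d + 1 +
      𝒜.density d * ((n : ℝ) - ((n / s * s : ℕ) : ℝ)) ≤ B / d + 1 + 𝒜.density d * B := by
    have e1 := div_le_div_of_nonneg_right hmod hd0.le
    have e2 := mul_le_mul_of_nonneg_left hmod hg
    linarith
  have hgrid : |𝒜.remainder d ((n / s * s : ℕ) : ℝ)| ≤
      ∑ k ∈ Finset.range (⌊x⌋₊ / s + 1), |𝒜.remainder d ((k * s : ℕ) : ℝ)| :=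
    Finset.single_le_sum (f := fun k : ℕ => |𝒜.remainder d ((k * s : ℕ) : ℝ)|)
      (fun k _ => abs_nonneg _)
      (Finset.mem_range.mpr (Nat.lt_succ_of_le (Nat.div_le_div_right hnx)))
  have htri := abs_sub_abs_le_abs_sub (𝒜.remainder d (n : ℝ)) (𝒜.remainder d ((n / s * s : ℕ) : ℝ))
  rw [remainder_eq_floor 𝒜 hsize d y]
  linarith

/-- **The grid sums**: if every body-by-body sum at a truncation `≤ x` is `≤ Rw` (`x ≥ 0`), then
`Σ_{d ∈ 𝒟} Σ_{k ≤ ⌊x⌋₊/s} |r_d(k s)| ≤ (⌊x⌋₊/s + 1) Rw` (exchange the sums; each `k s ≤ x`).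
[folklore] -/
theorem sum_grid_le (𝒜 : SieveSequence) (𝒟 : Finset ℕ) {x Rw : ℝ} (hx : 0 ≤ x) (s : ℕ)
    (hRw : ∀ y : ℝ, y ≤ x → ∑ d ∈ 𝒟, |𝒜.remainder d y| ≤ Rw) :
    ∑ d ∈ 𝒟, ∑ k ∈ Finset.range (⌊x⌋₊ / s + 1), |𝒜.remainder d ((k * s : ℕ) : ℝ)| ≤
      (((⌊x⌋₊ / s : ℕ) : ℝ) + 1) * Rw := by
  have hpt : ∀ k ∈ Finset.range (⌊x⌋₊ / s + 1), ((k * s : ℕ) : ℝ) ≤ x := fun k hk => by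
    have hk' : k ≤ ⌊x⌋₊ / s := Nat.lt_succ_iff.mp (Finset.mem_range.mp hk)
    have h1 : k * s ≤ ⌊x⌋₊ := (Nat.mul_le_mul_right s hk').trans (Nat.div_mul_le_self _ _)
    calc ((k * s : ℕ) : ℝ) ≤ (⌊x⌋₊ : ℝ) := by exact_mod_cast h1
      _ ≤ x := Nat.floor_le hx
  rw [Finset.sum_comm]
  calc ∑ k ∈ Finset.range (⌊x⌋₊ / s + 1), ∑ d ∈ 𝒟, |𝒜.remainder d ((k * s : ℕ) : ℝ)|
      ≤ ∑ k ∈ Finset.range (⌊x⌋₊ / s + 1), Rw := Finset.sum_le_sum fun k hk => hRw _ (hpt k hk)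
    _ = (((⌊x⌋₊ / s : ℕ) : ℝ) + 1) * Rw := by
        rw [Finset.sum_const, Finset.card_range, nsmul_eq_mul]
        push_cast
        ring

/-- The grid `{k s : k ≤ ⌊x⌋₊/s}` has `⌊x⌋₊/s + 1 ≤ Y + 1` points when `s ≥ x/Y > 0`. [folklore] -/
theorem grid_card_le {x Y : ℝ} (hx : 0 ≤ x) (hY : 0 < Y) {s : ℕ} (hs : 0 < s) (hsY : x / Y ≤ s) :
    ((⌊x⌋₊ / s : ℕ) : ℝ) ≤ Y := by
  have hs0 : (0 : ℝ) < s := by exact_mod_cast hs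
  have hsY' : x ≤ (s : ℝ) * Y := (div_le_iff₀ hY).mp hsY
  calc ((⌊x⌋₊ / s : ℕ) : ℝ) ≤ (⌊x⌋₊ : ℝ) / s := Nat.cast_div_le
    _ ≤ x / s := div_le_div_of_nonneg_right (Nat.floor_le hx) hs0.le
    _ ≤ Y := by
        rw [div_le_iff₀ hs0]
        calc x ≤ (s : ℝ) * Y := hsY'
          _ = Y * s := mul_comm _ _

/-! ## The rounding-error sums -/

/-- `Σ_{d ≤ D sqfree} 1/d ≤ 1 + log x` for `D ≤ ⌊x⌋₊`, `x ≥ 2` (harmonic bound). [folklore] -/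
theorem sum_inv_le_log {x : ℝ} (hx : 2 ≤ x) {D : ℕ} (hD : D ≤ ⌊x⌋₊) :
    ∑ d ∈ (Finset.Icc 1 D).filter Squarefree, (1 : ℝ) / d ≤ 1 + Real.log x := by
  have hx0 : 0 < x := by linarith
  have hsub : (Finset.Icc 1 D).filter Squarefree ⊆ Finset.Icc 1 ⌊x⌋₊ :=
    (Finset.filter_subset _ _).trans (Finset.Icc_subset_Icc_right hD)
  calc ∑ d ∈ (Finset.Icc 1 D).filter Squarefree, (1 : ℝ) / d
      ≤ ∑ d ∈ Finset.Icc 1 ⌊x⌋₊, (1 : ℝ) / d :=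
        Finset.sum_le_sum_of_subset_of_nonneg hsub fun d _ _ => by positivity
    _ ≤ 1 + Real.log (⌊x⌋₊ : ℝ) := FibreInheritanceAux.sum_Icc_one_div_le_log _
    _ ≤ 1 + Real.log x := by
        have hfl0 : (0 : ℝ) < (⌊x⌋₊ : ℝ) := by exact_mod_cast Nat.floor_pos.mpr (by linarith)
        linarith [Real.log_le_log hfl0 (Nat.floor_le hx0.le)]

/-- `Σ_{d ≤ D sqfree} g(d) ≤ 4(1 + 2|L'|) log x` for `D ≤ ⌊x⌋₊`, `x ≥ 2`, under `Ω(1, L')`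
(`FibreInheritanceAux.sum_squarefree_density_le_log`). [folklore] -/
theorem sum_density_le_log (𝒜 : SieveSequence) {L' x : ℝ} (hdim : HasIwaniecDimension 𝒜.density 1 L')
    (hx : 2 ≤ x) {D : ℕ} (hD : D ≤ ⌊x⌋₊) :
    ∑ d ∈ (Finset.Icc 1 D).filter Squarefree, 𝒜.density d ≤ 4 * (1 + 2 * |L'|) * Real.log x := by
  have hsub : (Finset.Icc 1 D).filter Squarefree ⊆ (Finset.Icc 1 ⌊x⌋₊).filter Squarefree :=
    Finset.filter_subset_filter _ (Finset.Icc_subset_Icc_right hD)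
  calc ∑ d ∈ (Finset.Icc 1 D).filter Squarefree, 𝒜.density d
      ≤ ∑ d ∈ (Finset.Icc 1 ⌊x⌋₊).filter Squarefree, 𝒜.density d :=
        Finset.sum_le_sum_of_subset_of_nonneg hsub fun d hd _ =>
          𝒜.density_mult.nonneg_of_squarefree (fun p hp => (hdim.1 p hp).1) (Finset.mem_filter.mp hd).2
    _ ≤ 4 * (1 + 2 * |L'|) * Real.log x :=
        FibreInheritanceAux.sum_squarefree_density_le_log 𝒜.density_mult hdim hx

end CoveringAux

open CoveringAux in
/-- **`stub_coveringInequality`** (registered stub of skeleton v18, line `section-annihilator`): the covering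
inequality `CoveringInequality` with `A₃ = 1`, `C = 3 + 4(1 + 2|L'|)` — for weights in `[0, 1]`, size =
counting function and a density of Iwaniec dimension `Ω(1, L')`, every strong Type-I sum over a selection
`y_d ≤ x` is at most `(Y + 2) Rw + C (x/Y + x^{1-η}) log x` when `Rw` bounds the body-by-body sums at all
truncations `y ≤ x`: round each `⌊y_d⌋₊` down to the grid of multiples of `⌈x/Y⌉` (at most `Y + 1` points
`≤ x`, each charged `Rw`), at a cost `(x/Y)/d + 1 + g(d) x/Y` per modulus, and sum
(`Σ 1/d ≤ 1 + log x`, `#𝒟 ≤ x^{1-η}`, `Σ g(d) ≤ 4(1+2|L'|) log x`). -/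
theorem stub_coveringInequality : CoveringInequality := by
  intro A₁ L'
  refine ⟨3 + 4 * (1 + 2 * |L'|), 1, by positivity, ?_⟩
  intro 𝒜 x η Rw Y hx hη hY ha hsize _hdens hdim hRw y hy
  rw [pow_one]
  -- ranges
  set D : ℕ := ⌊x ^ (1 - η)⌋₊ with hD
  set s : ℕ := ⌈x / Y⌉₊ with hs
  have hx0 : 0 < x := by linarith
  have hx1 : 1 ≤ x := by linarith
  have hY0 : 0 < Y := by linarith
  have hxY : 0 < x / Y := div_pos hx0 hY0
  have hs0 : 0 < s := Nat.ceil_pos.mpr hxY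
  have hsY : x / Y ≤ s := Nat.le_ceil _
  have hsB : (s : ℝ) ≤ x / Y + 1 := (Nat.ceil_lt_add_one hxY.le).le
  have hL0 : 0 ≤ 4 * (1 + 2 * |L'|) := by positivity
  have hpow_le : x ^ (1 - η) ≤ x := by
    calc x ^ (1 - η) ≤ x ^ (1 : ℝ) := Real.rpow_le_rpow_of_exponent_le hx1 (by linarith)
      _ = x := Real.rpow_one x
  have hpow0 : 0 ≤ x ^ (1 - η) := Real.rpow_nonneg hx0.le _
  have hDM : D ≤ ⌊x⌋₊ := Nat.floor_le_floor hpow_le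
  have hDle : (D : ℝ) ≤ x ^ (1 - η) := Nat.floor_le hpow0
  have hRw0 : 0 ≤ Rw := (Finset.sum_nonneg fun d _ => abs_nonneg _).trans (hRw x le_rfl)
  have hg0 : ∀ d ∈ (Finset.Icc 1 D).filter Squarefree, 0 ≤ 𝒜.density d := fun d hd =>
    𝒜.density_mult.nonneg_of_squarefree (fun p hp => (hdim.1 p hp).1) (Finset.mem_filter.mp hd).2
  have hlog : 1 ≤ 2 * Real.log x := FibreInheritanceAux.one_le_two_mul_log hx
  -- Step 1: round every truncation down to the grid, modulus by modulus, and sum over `d`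
  have hpt : ∀ d ∈ (Finset.Icc 1 D).filter Squarefree,
      |𝒜.remainder d (y d)| ≤
        ∑ k ∈ Finset.range (⌊x⌋₊ / s + 1), |𝒜.remainder d ((k * s : ℕ) : ℝ)| +
          (x / Y / d + 1 + 𝒜.density d * (x / Y)) := fun d hd =>
    abs_remainder_le_grid 𝒜 ha hsize (Finset.mem_Icc.mp (Finset.mem_filter.mp hd).1).1 (hg0 d hd)
      hs0 hsB (hy d)
  have hsum := Finset.sum_le_sum hpt
  rw [Finset.sum_add_distrib] at hsum
  -- Step 2: the grid sums contribute `(⌊x⌋₊/s + 1) Rw ≤ (Y + 1) Rw`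
  have hgrid := sum_grid_le 𝒜 ((Finset.Icc 1 D).filter Squarefree) hx0.le s hRw
  have hcnt := grid_card_le hx0.le hY0 hs0 hsY
  have hgrid' : ∑ d ∈ (Finset.Icc 1 D).filter Squarefree,
      ∑ k ∈ Finset.range (⌊x⌋₊ / s + 1), |𝒜.remainder d ((k * s : ℕ) : ℝ)| ≤ (Y + 1) * Rw :=
    hgrid.trans (mul_le_mul_of_nonneg_right (by linarith) hRw0)
  -- Step 3: the rounding errors
  have herr : ∑ d ∈ (Finset.Icc 1 D).filter Squarefree, (x / Y / d + 1 + 𝒜.density d * (x / Y)) ≤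
      x / Y * (1 + Real.log x) + x ^ (1 - η) + x / Y * (4 * (1 + 2 * |L'|) * Real.log x) := by
    rw [Finset.sum_add_distrib, Finset.sum_add_distrib]
    have h1 : ∑ d ∈ (Finset.Icc 1 D).filter Squarefree, x / Y / (d : ℝ) ≤ x / Y * (1 + Real.log x) := by
      have e : ∑ d ∈ (Finset.Icc 1 D).filter Squarefree, x / Y / (d : ℝ) =
          x / Y * ∑ d ∈ (Finset.Icc 1 D).filter Squarefree, (1 : ℝ) / d := by
        rw [Finset.mul_sum]
        exact Finset.sum_congr rfl fun d _ => div_eq_mul_one_div _ _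
      rw [e]
      exact mul_le_mul_of_nonneg_left (sum_inv_le_log hx hDM) hxY.le
    have h2 : ∑ d ∈ (Finset.Icc 1 D).filter Squarefree, (1 : ℝ) ≤ x ^ (1 - η) := by
      rw [Finset.sum_const, nsmul_eq_mul, mul_one]
      have hc : ((Finset.Icc 1 D).filter Squarefree).card ≤ D :=
        (Finset.card_filter_le _ _).trans (by simp)
      calc ((((Finset.Icc 1 D).filter Squarefree).card : ℕ) : ℝ) ≤ (D : ℝ) := by exact_mod_cast hc
        _ ≤ x ^ (1 - η) := hDle
    have h3 : ∑ d ∈ (Finset.Icc 1 D).filter Squarefree, 𝒜.density d * (x / Y) ≤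
        x / Y * (4 * (1 + 2 * |L'|) * Real.log x) := by
      rw [← Finset.sum_mul, mul_comm]
      exact mul_le_mul_of_nonneg_left (sum_density_le_log 𝒜 hdim hx hDM) hxY.le
    linarith
  -- Step 4: assembly (`2 log x ≥ 1` absorbs the constants)
  have hfin : (Y + 1) * Rw +
      (x / Y * (1 + Real.log x) + x ^ (1 - η) + x / Y * (4 * (1 + 2 * |L'|) * Real.log x)) ≤
      (Y + 2) * Rw + (3 + 4 * (1 + 2 * |L'|)) * (x / Y + x ^ (1 - η)) * Real.log x := by
    have hKl : 0 ≤ 4 * (1 + 2 * |L'|) * Real.log x := mul_nonneg hL0 (by linarith)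
    have ha' : 0 ≤ x / Y * (2 * Real.log x - 1) := mul_nonneg hxY.le (by linarith)
    have hb' : 0 ≤ x ^ (1 - η) * ((3 + 4 * (1 + 2 * |L'|)) * Real.log x - 1) :=
      mul_nonneg hpow0 (by linarith)
    linarith
  linarith [hsum, hgrid', herr, hfin]

end Summit.Parity.GeneralizedHardyLittlewood.Cruxes.CellParityLaw.SectionAnnihilator

end
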